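import Mathlib.RingTheory.MvPolynomial.Homogeneous
import Mathlib.Algebra.MvPolynomial.Monad
import Mathlib.LinearAlgebra.Matrix.Charpoly.Coeff
import Mathlib.LinearAlgebra.Matrix.Block
import Mathlib.LinearAlgebra.Matrix.Trace
import Mathlib.LinearAlgebra.Matrix.Notation
import Mathlib.LinearAlgebra.Matrix.NonsingularInverse
import Mathlib.Tactic.FieldSimp
import Mathlib.Tactic.LinearCombination
import HarnessLib

/-!
# Symmetric powers of `2 × 2` matrices on binary forms, and their characteristic polynomials
(crux stmt-Langlands-14329 `IrreducibilityBySelfDuality.IrreducibleOffSector`, line `Sketch`;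
`--supports` file, STRUCTURAL: no import of the route module; continuation lead c6)

Galois-side engine, part 1 (pure linear algebra over a commutative ring / a field), of the FIFTH
CLOSURE OPERATOR on the crux's conclusion — the SYMMETRIC-POWER ASCENT `Sym^m : GL_2 → GL_{m+1}`
(`…IrreducibleOffSectorSymmPower`, `…IrreducibleOffSectorSymmPowerAscent`).  The `m`-th symmetric
power of `g ∈ M_2(R)` is realised on binary forms of degree `m`: `R[X_0, X_1]_m` with basis
`X_0^{m-j} X_1^{j}` (`j = 0, …, m`) and the substitution `(P ∘ g)(X_0, X_1) = P((X_0, X_1) g)`,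
i.e. `X_i ↦ Σ_k g_{ki} X_k` (Mathlib `MvPolynomial.bind₁`).  NO DEFINITION is introduced: every
statement is about ANY function `S : M_2(R) → M_{m+1}(R)` with the entry formula
`S g i j = coeff_{(m-i, i)} (X_0^{m-j} X_1^{j} ∘ g)` (hypothesis `hS`), so that it applies verbatim
to a future Literature definition of `Sym^m`.

* §1 `bind₁_lin_mul`, `bind₁_lin_one`, `isHomogeneous_bind₁_lin` — the substitution is a
  (covariant) action by graded algebra endomorphisms;
* §2 `eq_sum_coeff_mul_monomial` — a binary form of degree `m` is `Σ_i coeff_{(m-i,i)} X_0^{m-i} X_1^i`;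
* §3 `S_mul`, `S_one` — `S (g h) = S g · S h`, `S 1 = 1` (the symmetric power is a representation);
* §4 `S_apply_of_lt`, `S_apply_diag`, `charpoly_S_of_upperTriangular` — for upper triangular `g`,
  `S g` is upper triangular with diagonal `g₀₀^{m-j} g₁₁^{j}` (the coefficient of `X_1^j` in
  `(a X_0 + b X_1)^j` is `b^j`), so `χ_{S g} = ∏_j (X - g₀₀^{m-j} g₁₁^{j})`
  (Mathlib `Matrix.charpoly_of_upperTriangular`);
* §5 `charpoly_S_eq_prod` — over a FIELD: `χ_g = (X - a)(X - b) ⟹ χ_{S g} = ∏_{j=0}^{m} (X - a^{m-j} b^{j})`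
  (if `g₁₀ ≠ 0`, `v = (a - g₁₁, g₁₀)` is an eigenvector for `a` and `P = (v | e₀)` conjugates `g` to the
  upper triangular `(a 1; 0 b)`; `S` of a conjugate is a conjugate, Mathlib `Matrix.charpoly_units_conj`).

Part 2 (`…SymmPower`): base change `S_map`, continuity, the continuous homomorphism
`GL_2(R) →ₜ* GL_{m+1}(R)`, framed representations, Frobenius polynomials and the Satake dictionary.

References: J.-P. Serre, *Linear representations of finite groups* (1977), §1.5–1.6 (symmetric
square; characters of symmetric powers); W. Fulton, J. Harris, *Representation Theory* (1991), §6.1,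
§11.1 (`Sym^m` of the standard representation of `GL_2`/`SL_2`, weights `a^{m-j} b^{j}`);
N. Bourbaki, *Algèbre*, Ch. III §6 (symmetric powers, functoriality).
-/

noncomputable section

set_option linter.dupNamespace false

open scoped Polynomial
open MvPolynomial Finsupp

namespace Summit.Langlands.Langlands.Theorems.IrreducibleOffSector

namespace SymmPower

variable {R : Type*} [CommRing R]

/-! ## 1. The linear substitution `X_i ↦ Σ_k g_{ki} X_k` attached to a `2 × 2` matrix -/

/-- The substitution attached to `g h` is the composite of the substitutions attached to `g` and
to `h` (covariance: `X_i ↦ Σ_k g_{ki} X_k`). [folklore] -/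
theorem bind₁_lin_mul (g h : Matrix (Fin 2) (Fin 2) R) (P : MvPolynomial (Fin 2) R) :
    bind₁ (fun i : Fin 2 => ∑ k : Fin 2, C ((g * h) k i) * X k) P =
      bind₁ (fun i : Fin 2 => ∑ k : Fin 2, C (g k i) * X k)
        (bind₁ (fun i : Fin 2 => ∑ k : Fin 2, C (h k i) * X k) P) := by
  have e : (fun i : Fin 2 => ∑ k : Fin 2, C ((g * h) k i) * X k) = fun i : Fin 2 =>
      bind₁ (fun i : Fin 2 => ∑ k : Fin 2, C (g k i) * X k) (∑ k : Fin 2, C (h k i) * X k) := by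
    funext i
    simp only [map_sum, map_mul, bind₁_C_right, bind₁_X_right, Matrix.mul_apply, map_sum (C),
      Finset.sum_mul, Finset.mul_sum, map_mul (C)]
    rw [Finset.sum_comm]
    refine Finset.sum_congr rfl fun k _ => Finset.sum_congr rfl fun l _ => ?_
    ring
  rw [bind₁_bind₁, e]

/-- The substitution attached to the identity matrix is the identity. [folklore] -/
theorem bind₁_lin_one (P : MvPolynomial (Fin 2) R) :
    bind₁ (fun i : Fin 2 => ∑ k : Fin 2, C ((1 : Matrix (Fin 2) (Fin 2) R) k i) * X k) P = P := by
  have h : (fun i : Fin 2 => ∑ k : Fin 2, C ((1 : Matrix (Fin 2) (Fin 2) R) k i) * X k) = X := by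
    funext i
    simp [Matrix.one_apply]
  rw [h, bind₁_X_left, AlgHom.id_apply]

/-- A linear substitution preserves homogeneity of each degree. [folklore] -/
theorem isHomogeneous_bind₁_lin (g : Matrix (Fin 2) (Fin 2) R) {P : MvPolynomial (Fin 2) R}
    {n : ℕ} (hP : P.IsHomogeneous n) :
    (bind₁ (fun i : Fin 2 => ∑ k : Fin 2, C (g k i) * X k) P).IsHomogeneous n := by
  have h := hP.aeval (fun i : Fin 2 => ∑ k : Fin 2, C (g k i) * X k) (n := 1) fun i => ?_
  · simpa using h
  · refine IsHomogeneous.sum _ _ _ fun k _ => ?_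
    simpa using (isHomogeneous_C (Fin 2) (g k i)).mul (isHomogeneous_X R k)

/-! ## 2. Binary forms of degree `m`: the monomial basis `X_0^{m-j} X_1^j` -/

/-- The exponent vector of `X_0^{m-i} X_1^{i}`. Injective in `i ≤ m` (read off the `X_1`-exponent).
[folklore] -/
theorem expVec_injective (m : ℕ) {i i' : ℕ}
    (h : (single 0 (m - i) + single 1 i : Fin 2 →₀ ℕ) = single 0 (m - i') + single 1 i') :
    i = i' := by
  have := congrArg (fun d : Fin 2 →₀ ℕ => d 1) h
  simpa using this

/-- `X_0^{m-j} X_1^j` is the monomial with exponent vector `(m-j, j)`. [folklore] -/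
theorem X_pow_mul_X_pow_eq_monomial (m j : ℕ) :
    (X 0 ^ (m - j) * X 1 ^ j : MvPolynomial (Fin 2) R) =
      monomial (single 0 (m - j) + single 1 j) 1 := by
  rw [X_pow_eq_monomial, X_pow_eq_monomial, monomial_mul, one_mul]

/-- `X_0^{m-j} X_1^j` is homogeneous of degree `m` (`j ≤ m`). [folklore] -/
theorem isHomogeneous_X_pow_mul_X_pow {m j : ℕ} (hj : j ≤ m) :
    (X 0 ^ (m - j) * X 1 ^ j : MvPolynomial (Fin 2) R).IsHomogeneous m := by
  rw [X_pow_mul_X_pow_eq_monomial]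
  apply isHomogeneous_monomial
  rw [map_add, degree_single, degree_single]
  omega

/-- **Expansion of a binary form of degree `m` in the monomial basis**: a homogeneous
`P ∈ R[X_0, X_1]` of degree `m` is `Σ_{i=0}^{m} coeff_{(m-i,i)}(P) · X_0^{m-i} X_1^{i}`. [folklore] -/
theorem eq_sum_coeff_mul_monomial {m : ℕ} {P : MvPolynomial (Fin 2) R} (hP : P.IsHomogeneous m) :
    P = ∑ i : Fin (m + 1), C (coeff (single 0 (m - i) + single 1 (i : ℕ)) P) *
      (X 0 ^ (m - i) * X 1 ^ (i : ℕ) : MvPolynomial (Fin 2) R) := by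
  classical
  refine MvPolynomial.ext _ _ fun d => ?_
  simp only [coeff_sum, X_pow_mul_X_pow_eq_monomial, coeff_C_mul, coeff_monomial,
    mul_ite, mul_one, mul_zero]
  by_cases hd : d.degree = m
  · -- `d = (m - i, i)` with `i = d 1 ≤ m`
    have hd2 : d 0 + d 1 = m := by rw [← hd, degree_eq_sum, Fin.sum_univ_two]
    have hdi : d = single 0 (m - d 1) + single 1 (d 1) := by
      ext k
      fin_cases k
      · simp; omega
      · simp
    rw [Finset.sum_eq_single (⟨d 1, by omega⟩ : Fin (m + 1))]
    · rw [if_pos hdi.symm, ← hdi]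
    · intro i _ hi
      rw [if_neg]
      intro h
      apply hi
      rw [hdi] at h
      exact Fin.ext (expVec_injective m h)
    · exact fun h => absurd (Finset.mem_univ _) h
  · rw [hP.coeff_eq_zero hd, eq_comm]
    refine Finset.sum_eq_zero fun i _ => if_neg fun h => hd ?_
    rw [← h, map_add, degree_single, degree_single]
    have := i.2
    omega

/-! ## 3. The matrix of `Sym^m g` on binary forms of degree `m`

`S g` is the matrix, in the basis `X_0^{m-j} X_1^{j}` (`j = 0, …, m`), of the substitution
`P(X_0, X_1) ↦ P((X_0, X_1) g)` restricted to forms of degree `m`: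
`S g i j = coeff_{(m-i, i)} (X_0^{m-j} X_1^{j} ∘ g)`.  No definition is introduced: every statement
is about ANY function `S` with this formula (hypothesis `hS`). -/

section Matrix

variable {m : ℕ} {S : Matrix (Fin 2) (Fin 2) R → Matrix (Fin (m + 1)) (Fin (m + 1)) R}

/-- **The substituted monomial expands with coefficients `S g · j`**:
`X_0^{m-j} X_1^{j} ∘ g = Σ_i S g i j · X_0^{m-i} X_1^{i}`. [folklore] -/
theorem bind₁_lin_monomial_eq_sum
    (hS : ∀ g i j, S g i j = coeff (single 0 (m - i) + single 1 (i : ℕ))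
      (bind₁ (fun i : Fin 2 => ∑ k : Fin 2, C (g k i) * X k) (X 0 ^ (m - j) * X 1 ^ (j : ℕ))))
    (g : Matrix (Fin 2) (Fin 2) R) (j : Fin (m + 1)) :
    bind₁ (fun i : Fin 2 => ∑ k : Fin 2, C (g k i) * X k) (X 0 ^ (m - j) * X 1 ^ (j : ℕ)) =
      ∑ i : Fin (m + 1), C (S g i j) * (X 0 ^ (m - i) * X 1 ^ (i : ℕ) : MvPolynomial (Fin 2) R) := by
  have hhom := isHomogeneous_bind₁_lin g
    (isHomogeneous_X_pow_mul_X_pow (R := R) (m := m) (j := j) (by have := j.2; omega))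
  conv_lhs => rw [eq_sum_coeff_mul_monomial hhom]
  simp only [hS]

/-- **Multiplicativity**: `S (g h) = S g · S h` (the symmetric power is a representation).
[folklore] -/
theorem S_mul
    (hS : ∀ g i j, S g i j = coeff (single 0 (m - i) + single 1 (i : ℕ))
      (bind₁ (fun i : Fin 2 => ∑ k : Fin 2, C (g k i) * X k) (X 0 ^ (m - j) * X 1 ^ (j : ℕ))))
    (g h : Matrix (Fin 2) (Fin 2) R) : S (g * h) = S g * S h := by
  ext i j
  rw [Matrix.mul_apply, hS, bind₁_lin_mul, bind₁_lin_monomial_eq_sum hS h j]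
  simp only [map_sum, coeff_sum]
  refine Finset.sum_congr rfl fun k _ => ?_
  rw [map_mul, bind₁_C_right, coeff_C_mul, ← hS, mul_comm]

/-- `S 1 = 1`. [folklore] -/
theorem S_one
    (hS : ∀ g i j, S g i j = coeff (single 0 (m - i) + single 1 (i : ℕ))
      (bind₁ (fun i : Fin 2 => ∑ k : Fin 2, C (g k i) * X k) (X 0 ^ (m - j) * X 1 ^ (j : ℕ)))) :
    S 1 = 1 := by
  classical
  ext i j
  rw [hS, bind₁_lin_one, X_pow_mul_X_pow_eq_monomial, coeff_monomial, Matrix.one_apply]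
  by_cases hij : i = j
  · subst hij; simp
  · rw [if_neg, if_neg hij]
    exact fun h => hij (Fin.ext (expVec_injective m h)).symm

/-! ## 4. Upper triangular `g` give upper triangular `S g`; the characteristic polynomial -/

/-- The coefficient of `X_1^n` in `(a X_0 + b X_1)^n` is `b^n`. [folklore] -/
theorem coeff_single_one_linear_pow (a b : R) (n : ℕ) :
    coeff (single 1 n) ((C a * X 0 + C b * X 1 : MvPolynomial (Fin 2) R) ^ n) = b ^ n := by
  classical
  induction n with
  | zero => simp
  | succ n ih =>
    rw [pow_succ, mul_add, ← mul_assoc, ← mul_assoc, coeff_add, coeff_mul_X', coeff_mul_X',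
      if_neg (by simp), if_pos (by simp), zero_add, mul_comm _ (C b), coeff_C_mul,
      ← Finsupp.single_tsub, Nat.add_sub_cancel, ih, pow_succ, mul_comm]

/-- For an upper triangular `g` (`g 1 0 = 0`): `X_0^{m-j} X_1^{j} ∘ g = g₀₀^{m-j} X_0^{m-j} · (g₀₁ X_0 + g₁₁ X_1)^j`.
[folklore] -/
theorem bind₁_lin_monomial_of_upperTriangular {g : Matrix (Fin 2) (Fin 2) R} (hg : g 1 0 = 0)
    (j : ℕ) :
    bind₁ (fun i : Fin 2 => ∑ k : Fin 2, C (g k i) * X k) (X 0 ^ (m - j) * X 1 ^ j) =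
      monomial (single 0 (m - j)) (g 0 0 ^ (m - j)) *
        (C (g 0 1) * X 0 + C (g 1 1) * X 1) ^ j := by
  simp only [map_mul, map_pow, bind₁_X_right, Fin.sum_univ_two, hg, C_0, zero_mul, add_zero]
  rw [mul_pow, ← map_pow, X_pow_eq_monomial, C_mul_monomial, mul_one]

/-- **`S g` is upper triangular when `g` is**, with diagonal entries `g₀₀^{m-j} g₁₁^{j}`:
entries below the diagonal vanish … [folklore] -/
theorem S_apply_of_lt
    (hS : ∀ g i j, S g i j = coeff (single 0 (m - i) + single 1 (i : ℕ))
      (bind₁ (fun i : Fin 2 => ∑ k : Fin 2, C (g k i) * X k) (X 0 ^ (m - j) * X 1 ^ (j : ℕ))))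
    {g : Matrix (Fin 2) (Fin 2) R} (hg : g 1 0 = 0) {i j : Fin (m + 1)} (hji : j < i) :
    S g i j = 0 := by
  rw [hS, bind₁_lin_monomial_of_upperTriangular hg, coeff_monomial_mul', if_neg]
  intro hle
  have h0 := hle 0
  simp at h0
  have := i.2
  have := Fin.lt_def.mp hji
  omega

/-- … and the diagonal entry is `S g j j = g₀₀^{m-j} g₁₁^{j}`. [folklore] -/
theorem S_apply_diag
    (hS : ∀ g i j, S g i j = coeff (single 0 (m - i) + single 1 (i : ℕ))
      (bind₁ (fun i : Fin 2 => ∑ k : Fin 2, C (g k i) * X k) (X 0 ^ (m - j) * X 1 ^ (j : ℕ))))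
    {g : Matrix (Fin 2) (Fin 2) R} (hg : g 1 0 = 0) (j : Fin (m + 1)) :
    S g j j = g 0 0 ^ (m - j) * g 1 1 ^ (j : ℕ) := by
  rw [hS, bind₁_lin_monomial_of_upperTriangular hg, coeff_monomial_mul', if_pos le_self_add,
    add_tsub_cancel_left, coeff_single_one_linear_pow]

/-- **Characteristic polynomial of `S g` for upper triangular `g`**:
`χ_{S g} = ∏_{j=0}^{m} (X - g₀₀^{m-j} g₁₁^{j})`. [folklore] -/
theorem charpoly_S_of_upperTriangular
    (hS : ∀ g i j, S g i j = coeff (single 0 (m - i) + single 1 (i : ℕ))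
      (bind₁ (fun i : Fin 2 => ∑ k : Fin 2, C (g k i) * X k) (X 0 ^ (m - j) * X 1 ^ (j : ℕ))))
    {g : Matrix (Fin 2) (Fin 2) R} (hg : g 1 0 = 0) :
    (S g).charpoly = ∏ j : Fin (m + 1),
      (Polynomial.X - Polynomial.C (g 0 0 ^ (m - j) * g 1 1 ^ (j : ℕ))) := by
  have htri : (S g).BlockTriangular id := fun i j hji => S_apply_of_lt hS hg hji
  rw [Matrix.charpoly_of_upperTriangular _ htri]
  exact Finset.prod_congr rfl fun j _ => by rw [S_apply_diag hS hg j]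

end Matrix

/-! ## 5. Over a field: the characteristic polynomial of `S g` from that of `g` -/

section Field

/-- The symmetric-power product is symmetric in the two roots:
`∏_j (X - a^{m-j} b^{j}) = ∏_j (X - b^{m-j} a^{j})` (reindex `j ↦ m - j`). [folklore] -/
theorem prod_X_sub_C_pow_mul_pow_comm {R : Type*} [CommRing R] (m : ℕ) (a b : R) :
    ∏ j : Fin (m + 1), (Polynomial.X - Polynomial.C (a ^ (m - j) * b ^ (j : ℕ))) =
      ∏ j : Fin (m + 1), (Polynomial.X - Polynomial.C (b ^ (m - j) * a ^ (j : ℕ))) := by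
  rw [Fin.prod_univ_eq_prod_range (fun j => Polynomial.X - Polynomial.C (a ^ (m - j) * b ^ j)) (m + 1),
    Fin.prod_univ_eq_prod_range (fun j => Polynomial.X - Polynomial.C (b ^ (m - j) * a ^ j)) (m + 1),
    ← Finset.prod_range_reflect (fun j => Polynomial.X - Polynomial.C (b ^ (m - j) * a ^ j)) (m + 1)]
  refine Finset.prod_congr rfl fun j hj => ?_
  rw [Finset.mem_range] at hj
  simp only [add_tsub_cancel_right]
  rw [Nat.sub_sub_self (by omega : j ≤ m), mul_comm]

/-- Two monic quadratics with the same roots: `(X-a)(X-b) = (X-c)(X-d)` over a domain forces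
`{a, b} = {c, d}`. [folklore] -/
theorem pair_eq_of_X_sub_C_mul_eq {R : Type*} [CommRing R] [IsDomain R] {a b c d : R}
    (h : (Polynomial.X - Polynomial.C a) * (Polynomial.X - Polynomial.C b) =
      (Polynomial.X - Polynomial.C c) * (Polynomial.X - Polynomial.C d)) :
    (a = c ∧ b = d) ∨ (a = d ∧ b = c) := by
  have hr := congrArg Polynomial.roots h
  rw [Polynomial.roots_mul ((Polynomial.monic_X_sub_C a).mul (Polynomial.monic_X_sub_C b)).ne_zero,
    Polynomial.roots_mul ((Polynomial.monic_X_sub_C c).mul (Polynomial.monic_X_sub_C d)).ne_zero,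
    Polynomial.roots_X_sub_C, Polynomial.roots_X_sub_C, Polynomial.roots_X_sub_C,
    Polynomial.roots_X_sub_C, Multiset.singleton_add, Multiset.singleton_add,
    Multiset.cons_eq_cons] at hr
  rcases hr with ⟨hac, hbd⟩ | ⟨-, cs, hb, hd⟩
  · exact Or.inl ⟨hac, Multiset.singleton_inj.mp hbd⟩
  · rw [Multiset.singleton_eq_cons_iff] at hd
    obtain ⟨rfl, rfl⟩ := hd
    rw [Multiset.cons_zero, Multiset.singleton_inj] at hb
    exact Or.inr ⟨rfl, hb⟩

/-- Trace and determinant of a `2 × 2` matrix with characteristic polynomial `(X-a)(X-b)`: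
`a + b = g₀₀ + g₁₁` and `a b = g₀₀ g₁₁ - g₀₁ g₁₀`. [folklore] -/
theorem trace_det_of_charpoly_eq {F : Type*} [Field F] {g : Matrix (Fin 2) (Fin 2) F} {a b : F}
    (hg : g.charpoly = (Polynomial.X - Polynomial.C a) * (Polynomial.X - Polynomial.C b)) :
    a + b = g 0 0 + g 1 1 ∧ a * b = g 0 0 * g 1 1 - g 0 1 * g 1 0 := by
  rw [Matrix.charpoly_fin_two, Matrix.trace_fin_two, Matrix.det_fin_two] at hg
  have e : (Polynomial.X - Polynomial.C a) * (Polynomial.X - Polynomial.C b) =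
      Polynomial.X ^ 2 - Polynomial.C (a + b) * Polynomial.X + Polynomial.C (a * b) := by
    simp only [map_add, map_mul]; ring
  rw [e] at hg
  have h0 := congrArg (fun p : F[X] => p.coeff 0) hg
  have h1 := congrArg (fun p : F[X] => p.coeff 1) hg
  simp only [Polynomial.coeff_add, Polynomial.coeff_sub, Polynomial.coeff_X_pow,
    Polynomial.coeff_C_mul, Polynomial.coeff_X, Polynomial.coeff_C] at h0 h1
  norm_num at h0 h1
  exact ⟨by linear_combination h1, h0.symm⟩

/-- **The characteristic polynomial of `Sym^m g`.**  Over a field, for any multiplicative `S`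
with the symmetric-power formula and `g ∈ GL_2` with `χ_g = (X - a)(X - b)`:
`χ_{S g} = ∏_{j=0}^{m} (X - a^{m-j} b^{j})`.  Proof: if `g` is upper triangular, read off the
diagonal; otherwise `v = (a - g₁₁, g₁₀)` is an eigenvector for `a`, `P = (v | e₀)` conjugates `g`
to the upper triangular `T = (a 1; 0 b)`, and `S g = S P · S T · S P⁻¹` has the characteristic
polynomial of `S T`. [folklore] -/
theorem charpoly_S_eq_prod {F : Type*} [Field F] {m : ℕ}
    {S : Matrix (Fin 2) (Fin 2) F → Matrix (Fin (m + 1)) (Fin (m + 1)) F}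
    (hS : ∀ g i j, S g i j = coeff (single 0 (m - i) + single 1 (i : ℕ))
      (bind₁ (fun i : Fin 2 => ∑ k : Fin 2, C (g k i) * X k) (X 0 ^ (m - j) * X 1 ^ (j : ℕ))))
    (g : Matrix (Fin 2) (Fin 2) F) {a b : F}
    (hg : g.charpoly = (Polynomial.X - Polynomial.C a) * (Polynomial.X - Polynomial.C b)) :
    (S g).charpoly = ∏ j : Fin (m + 1),
      (Polynomial.X - Polynomial.C (a ^ (m - j) * b ^ (j : ℕ))) := by
  obtain ⟨htr, hdet⟩ := trace_det_of_charpoly_eq hg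
  by_cases h10 : g 1 0 = 0
  · -- `g` is already upper triangular, with diagonal `{g₀₀, g₁₁} = {a, b}`
    have hg' : g.charpoly = (Polynomial.X - Polynomial.C (g 0 0)) *
        (Polynomial.X - Polynomial.C (g 1 1)) := by
      rw [Matrix.charpoly_of_upperTriangular g (fun i j hji => ?_), Fin.prod_univ_two]
      fin_cases i <;> fin_cases j <;> simp at hji
      exact h10
    rcases pair_eq_of_X_sub_C_mul_eq (hg.symm.trans hg') with ⟨rfl, rfl⟩ | ⟨rfl, rfl⟩
    · exact charpoly_S_of_upperTriangular hS h10
    · rw [prod_X_sub_C_pow_mul_pow_comm]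
      exact charpoly_S_of_upperTriangular hS h10
  · -- conjugate `g` to `T = (a 1; 0 b)` by `P = (a - g₁₁, 1; g₁₀, 0)` (first column an
    -- eigenvector for `a`): `g P = P T`, `det P = -g₁₀ ≠ 0`
    obtain ⟨T, hT⟩ : ∃ T : Matrix (Fin 2) (Fin 2) F, T = !![a, 1; 0, b] := ⟨_, rfl⟩
    obtain ⟨P, hP⟩ : ∃ P : Matrix (Fin 2) (Fin 2) F, P = !![a - g 1 1, 1; g 1 0, 0] := ⟨_, rfl⟩
    have key : g * P = P * T := by
      ext i j
      simp only [Matrix.mul_apply, Fin.sum_univ_two, hP, hT, Matrix.of_apply, Matrix.cons_val',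
        Matrix.cons_val_zero, Matrix.cons_val_one, Matrix.cons_val_fin_one]
      fin_cases i <;> fin_cases j
      · simp only [Fin.zero_eta, Fin.isValue, Matrix.cons_val_zero]
        linear_combination (-a) * htr + hdet
      · simp only [Fin.zero_eta, Fin.isValue, Matrix.cons_val_zero, Fin.mk_one, Matrix.cons_val_one,
          Matrix.cons_val_fin_one]
        linear_combination (-1 : F) * htr
      · simp only [Fin.mk_one, Fin.isValue, Matrix.cons_val_one, Fin.zero_eta, Matrix.cons_val_zero]
        ring
      · simp
    have hdetP : IsUnit P.det := by
      rw [hP, Matrix.det_fin_two_of, isUnit_iff_ne_zero]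
      simpa using h10
    have hgP : g = P * T * P⁻¹ := by
      rw [← key, Matrix.mul_assoc, Matrix.mul_nonsing_inv P hdetP, Matrix.mul_one]
    -- `S g = U · S T · U⁻¹` for the unit `U = S P`
    let U : (Matrix (Fin (m + 1)) (Fin (m + 1)) F)ˣ :=
      ⟨S P, S P⁻¹, by rw [← S_mul hS, Matrix.mul_nonsing_inv P hdetP, S_one hS],
        by rw [← S_mul hS, Matrix.nonsing_inv_mul P hdetP, S_one hS]⟩
    have hSg : S g = U.val * S T * U.val⁻¹ := by
      rw [hgP, S_mul hS, S_mul hS, ← Matrix.coe_units_inv]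
      rfl
    rw [hSg, Matrix.charpoly_units_conj]
    have hT10 : T 1 0 = 0 := by simp [hT]
    rw [charpoly_S_of_upperTriangular hS hT10]
    simp [hT]

end Field

end SymmPower

end Summit.Langlands.Langlands.Theorems.IrreducibleOffSector

end
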